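import Mathlib.MeasureTheory.Integral.IntervalIntegral.FundThmCalculus
import Literature.Analysis.FluidPDE.CompressibleEulerExactSelfSimilarImplosion
import Literature.Analysis.FluidPDE.IsentropicEulerTorusUniqueness
import HarnessLib

/-!
# Domain of dependence at the core of the self-similar implosion (theorems only)

Topic `Literature/Analysis/FluidPDE`; namespace `Literature.Analysis.FluidPDE.CaolaboraEtAl2025`.
Companion of `CompressibleEulerExactSelfSimilarImplosion.lean` (the exact self-similar solution
`(u, σ)` — `ρ = (σ/3)³` — of the isentropic Euler equations of the monatomic gas on `ℝ³`
generated by a smooth radial profile `(Ū, S̄)`, blow-up time `T`, self-similar exponent `r > 1`,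
and its integrable speed bound `speed_bound_of_profile`), of
`IsentropicEulerFiniteSpeedOfPropagation.lean` (local uniqueness in acoustic cones with a
time-dependent speed bound, `IsentropicEuler.eqOn_cone_of_eqOn_ball_var`, after Dafermos,
*Hyperbolic Conservation Laws in Continuum Physics*, 2nd ed. 2005, Thm 5.2.1) and of
`IsentropicEulerTorusUniqueness.lean` (the `(u, σ)`-system of the periodic lift of a classical
solution on `𝕋³`, `IsentropicEuler.uσ_equations`). THEOREMS ONLY, no new facts (D-0026).

Cao-Labora–Gómez-Serrano–Shi–Staffilani, Remark 1.5 (p. 7 of the held text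
`paper-arxiv-2310.05325`): "Note that the Euler result with periodic boundary conditions and
radially symmetric perturbation can be easily deduced from the non-periodic one (…) via finite
speed of propagation". This file proves the finite-speed-of-propagation step of that deduction at
the implosion core, for the unperturbed profile:

* `hasDerivAt_coneRadius`, `coneRadius_eq_integral`: the acoustic radius
  `Γ(t) = M (T^{1/r} − (T−t)^{1/r}) = ∫₀ᵗ M r⁻¹ (T−s)^{1/r−1} ds` swept out by the speed bound
  `M r⁻¹ (T−t)^{1/r−1}` of the exact solution; it stays BOUNDED (`≤ M T^{1/r}`) up to the blow-up
  time although the speed does not (`r > 1`);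
* `eqOn_cone_of_profile`: any `C¹` solution `(u₂, σ₂)` of the `(u, σ)`-system (`α = 1/3`) on a
  slab `[0, t₁) × ℝ³`, `t₁ < T`, whose data agree with the exact self-similar data on a ball
  `B(x₀, R)` coincides with the exact solution on the curved cone `‖x − x₀‖ + Γ(t) < R`,
  `0 ≤ t < t₁` (the speed bound is frozen after `t₁` to feed the cone theorem a globally
  continuous speed);
* `lift_eq_exact_on_cone`: hence a classical solution `(ρ₂, u₂)` of the isentropic Euler
  equations with `γ = 5/3` on `[0, T₂) × 𝕋³` (`IsIsentropicEulerSolution (5/3) T₂ ρ₂ u₂`) whose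
  lifted data agree with the exact `(ρ, u)` on a ball `B(x₀, R) ⊂ ℝ³` has lift EQUAL to the
  exact solution on that cone, for `0 ≤ t < min(T₂, T)`;
* `core_density_of_periodic_solution`: in particular, if the core stays inside the cone
  (`‖x₀‖ + M T^{1/r} < R`), the density of ANY such periodic classical solution at the core is
  EXACTLY `(S̄(0)/(3r))³ (T−t)^{−3(1−1/r)}` for `0 ≤ t < min(T₂, T)` — the core growth law
  (last clause) of the named fact `CaolaboraEtAl2025_thm12_rates`;
* `core_law_of_thm11_monatomic`: the existential corollary from the vendored profile fact
  (`r ∈ (1.10102, 1.13476)`, `c = (S̄(0)/(3r))³ > 0`).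

What is NOT here: the EXISTENCE up to the blow-up time `T` of a periodic classical solution with
such local data (CGSS Thm 1.2: truncation §1.4, linear stability Prop. 1.8, bootstrap §3), which
needs a quantitative local well-posedness / continuation theory absent from the tree.
-/

noncomputable section

open Set Filter MeasureTheory
open scoped Topology ContDiff

namespace Literature.Analysis.FluidPDE

open Literature.MathematicalPhysics.KineticTheory (T3 V3)
open Literature.Analysis.FunctionSpaces

namespace CaolaboraEtAl2025

/-! ### The acoustic radius at the core -/

section ConeRadius

/-- The acoustic radius `Γ(τ) = M (T^{1/r} − (T−τ)^{1/r})` has derivative the speed bound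
`M r⁻¹ (T−t)^{1/r−1}` at `t < T`. [folklore] -/
theorem hasDerivAt_coneRadius {M T r t : ℝ} (ht : t < T) :
    HasDerivAt (fun τ => M * (T ^ (1 / r) - (T - τ) ^ (1 / r)))
      (M * (r⁻¹ * (T - t) ^ (1 / r - 1))) t := by
  have hl : T - t ≠ 0 := (sub_pos.mpr ht).ne'
  have h1 : HasDerivAt (fun τ => T - τ) (-1) t := by
    simpa using (hasDerivAt_id t).const_sub T
  have h2 := ((h1.rpow_const (p := 1 / r) (Or.inl hl)).const_sub (T ^ (1 / r))).const_mul M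
  refine h2.congr_deriv ?_
  simp only [one_div]
  ring

/-- The acoustic radius is the integral of the speed bound:
`∫₀ᵗ M r⁻¹ (T−s)^{1/r−1} ds = M (T^{1/r} − (T−t)^{1/r})` for `0 ≤ t < T`. [folklore] -/
theorem coneRadius_eq_integral {M T r t : ℝ} (ht0 : 0 ≤ t) (ht : t < T) :
    ∫ s in (0 : ℝ)..t, M * (r⁻¹ * (T - s) ^ (1 / r - 1)) =
      M * (T ^ (1 / r) - (T - t) ^ (1 / r)) := by
  have hderiv : ∀ s ∈ uIcc 0 t, HasDerivAt (fun τ => M * (T ^ (1 / r) - (T - τ) ^ (1 / r)))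
      (M * (r⁻¹ * (T - s) ^ (1 / r - 1))) s := by
    intro s hs
    rw [uIcc_of_le ht0] at hs
    exact hasDerivAt_coneRadius (hs.2.trans_lt ht)
  have hcont : ContinuousOn (fun s => M * (r⁻¹ * (T - s) ^ (1 / r - 1))) (uIcc 0 t) := by
    rw [uIcc_of_le ht0]
    refine continuousOn_const.mul (continuousOn_const.mul ?_)
    exact (continuousOn_const.sub continuousOn_id).rpow_const
      fun s hs => Or.inl (sub_pos.2 (hs.2.trans_lt ht)).ne'
  rw [intervalIntegral.integral_eq_sub_of_hasDerivAt hderiv hcont.intervalIntegrable]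
  simp

end ConeRadius

/-! ### Local uniqueness against the exact self-similar solution -/

section Cone

variable {r : ℝ} {U S : ℝ → ℝ}

/-- **Domain of dependence at the implosion core, `(u, σ)` form.** Let `(u, σ)` be the exact
self-similar solution generated by a smooth radial profile `(Ū, S̄)` solving the profile
equations with `Ū/ζ, S̄/ζ → 0` at infinity (as provided by the vendored fact
`BuckmasterCaolaboraGomezserrano2025_thm11_monatomic`), `r > 1`, blow-up time `T`. There is
`M ≥ 0` (depending only on the profile and `r`) such that: for every `t₁ < T` and every `C¹`
solution `(u₂, σ₂)` of `∂ₜσ + ∇σ·u + ⅓σ div u = 0`, `∂ₜu + (u·∇)u + ⅓σ∇σ = 0` on the slab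
`[0, t₁) × ℝ³` (the equations being required only on the cone) with `u₂(0,·) = u(0,·)`,
`σ₂(0,·) = σ(0,·)` on the ball `‖x − x₀‖ < R`, one has `u₂ = u`, `σ₂ = σ` on the curved cone
`‖x − x₀‖ + M (T^{1/r} − (T−t)^{1/r}) < R`, `0 ≤ t < t₁`. (Dafermos' Thm 5.2.1 in the
variable-speed form `IsentropicEuler.eqOn_cone_of_eqOn_ball_var`, fed with the integrable speed
bound `‖u‖ + |σ/3| ≤ M r⁻¹ (T−t)^{1/r−1}` of `speed_bound_of_profile`.)
[cite: Dafermos2005, §5.2, Thm 5.2.1] [cite: CaolaboraEtAl2025, Rem 1.5 p. 7; §1.3 p. 5] -/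
theorem eqOn_cone_of_profile {T : ℝ} {Ub : V3 → V3} {Sb : V3 → ℝ} {u : ℝ → V3 → V3}
    {σ : ℝ → V3 → ℝ} (hr : 1 < r)
    (hU : ContDiff ℝ ∞ fun y : V3 => (U ‖y‖ / ‖y‖) • y) (hS : ContDiff ℝ ∞ fun y : V3 => S ‖y‖)
    (hode : ∀ ζ : ℝ, 0 < ζ →
      (r - 1) * U ζ + (ζ + U ζ) * deriv U ζ + 1 / 3 * S ζ * deriv S ζ = 0 ∧
      (r - 1) * S ζ + (ζ + U ζ) * deriv S ζ + 1 / 3 * S ζ * (deriv U ζ + 2 * U ζ / ζ) = 0)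
    (hlimU : Tendsto (fun ζ => U ζ / ζ) atTop (𝓝 0))
    (hlimS : Tendsto (fun ζ => S ζ / ζ) atTop (𝓝 0))
    (hUb : Ub = fun y : V3 => (U ‖y‖ / ‖y‖) • y) (hSb : Sb = fun y : V3 => S ‖y‖)
    (hu : ∀ t x, u t x = (r⁻¹ * (T - t) ^ (1 / r - 1)) • Ub ((T - t) ^ (-1 / r) • x))
    (hσ : ∀ t x, σ t x = (r⁻¹ * (T - t) ^ (1 / r - 1)) * Sb ((T - t) ^ (-1 / r) • x)) :
    ∃ M : ℝ, 0 ≤ M ∧ ∀ ⦃t₁ : ℝ⦄, t₁ < T →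
      ∀ ⦃u₂ : ℝ → V3 → V3⦄ ⦃σ₂ : ℝ → V3 → ℝ⦄ ⦃x₀ : V3⦄ ⦃R : ℝ⦄,
        ContDiffOn ℝ 1 (fun p : ℝ × V3 => u₂ p.1 p.2) (Ico 0 t₁ ×ˢ univ) →
        ContDiffOn ℝ 1 (fun p : ℝ × V3 => σ₂ p.1 p.2) (Ico 0 t₁ ×ˢ univ) →
        (∀ t ∈ Ioo 0 t₁, ∀ x, ‖x - x₀‖ + M * (T ^ (1 / r) - (T - t) ^ (1 / r)) < R →
          deriv (fun s => σ₂ s x) t + fderiv ℝ (σ₂ t) x (u₂ t x) +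
              1 / 3 * σ₂ t x * ∑ i, fderiv ℝ (u₂ t) x (EuclideanSpace.single i 1) i = 0 ∧
            deriv (fun s => u₂ s x) t + fderiv ℝ (u₂ t) x (u₂ t x) +
              (1 / 3 * σ₂ t x) • gradient (σ₂ t) x = 0) →
        (∀ x, ‖x - x₀‖ < R → u 0 x = u₂ 0 x ∧ σ 0 x = σ₂ 0 x) →
        ∀ ⦃t : ℝ⦄, t ∈ Ico 0 t₁ → ∀ ⦃x : V3⦄,
          ‖x - x₀‖ + M * (T ^ (1 / r) - (T - t) ^ (1 / r)) < R →
          u t x = u₂ t x ∧ σ t x = σ₂ t x := by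
  obtain ⟨M, hM0, hM⟩ := speed_bound_of_profile hr hU hS hode hlimU hlimS hUb hSb hu hσ
  refine ⟨M, hM0, ?_⟩
  intro t₁ ht₁ u₂ σ₂ x₀ R hu₂ hσ₂ hE₂ h0 t ht x hx
  have hr0 : 0 < r := one_pos.trans hr
  have hUb1 : ContDiff ℝ 1 Ub := hUb ▸ hU.of_le (by norm_cast)
  have hSb1 : ContDiff ℝ 1 Sb := hSb ▸ hS.of_le (by norm_cast)
  have hP1 : ∀ y, (r - 1) • Ub y + fderiv ℝ Ub y (y + Ub y) +
      (1 / 3 * Sb y) • gradient Sb y = 0 := by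
    subst hUb hSb; exact profileEq_velocity hU hS hode
  have hP2 : ∀ y, (r - 1) * Sb y + fderiv ℝ Sb y (y + Ub y) +
      1 / 3 * Sb y * ∑ i, (fderiv ℝ Ub y (EuclideanSpace.single i 1)) i = 0 := by
    subst hUb hSb; exact profileEq_soundSpeed hU hS hode
  -- joint regularity of the exact solution on the slab (indeed on `{t < T}`)
  have hsm : ContDiffOn ℝ 1 (fun p : ℝ × V3 => u p.1 p.2) (Ico 0 t₁ ×ˢ univ) ∧
      ContDiffOn ℝ 1 (fun p : ℝ × V3 => σ p.1 p.2) (Ico 0 t₁ ×ˢ univ) := by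
    have hsub : Ico 0 t₁ ×ˢ (univ : Set V3) ⊆ {p : ℝ × V3 | p.1 < T} :=
      fun p hp => hp.1.2.trans ht₁
    have hl : ContDiffOn ℝ 1 (fun p : ℝ × V3 => T - p.1) {p | p.1 < T} :=
      (contDiff_const.sub contDiff_fst).contDiffOn
    have hl0 : ∀ p ∈ {p : ℝ × V3 | p.1 < T}, T - p.1 ≠ 0 := fun p hp => (sub_pos.mpr hp).ne'
    have hamp : ContDiffOn ℝ 1 (fun p : ℝ × V3 => r⁻¹ * (T - p.1) ^ (1 / r - 1)) {p | p.1 < T} :=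
      contDiffOn_const.mul (hl.rpow_const_of_ne hl0)
    have hy : ContDiffOn ℝ 1 (fun p : ℝ × V3 => (T - p.1) ^ (-1 / r) • p.2) {p | p.1 < T} :=
      (hl.rpow_const_of_ne hl0).smul contDiff_snd.contDiffOn
    have hU' : ContDiffOn ℝ 1 (fun p : ℝ × V3 => Ub ((T - p.1) ^ (-1 / r) • p.2))
        {p | p.1 < T} := hUb1.comp_contDiffOn hy
    have hS' : ContDiffOn ℝ 1 (fun p : ℝ × V3 => Sb ((T - p.1) ^ (-1 / r) • p.2))
        {p | p.1 < T} := hSb1.comp_contDiffOn hy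
    exact ⟨((hamp.smul hU').congr fun p _ => hu p.1 p.2).mono hsub,
      ((hamp.mul hS').congr fun p _ => hσ p.1 p.2).mono hsub⟩
  -- the speed bound frozen after `t₁`, and the acoustic radius it sweeps out
  have hmin : ∀ s : ℝ, min s t₁ < T := fun s => (min_le_right s t₁).trans_lt ht₁
  set c : ℝ → ℝ := fun s => M * (r⁻¹ * (T - min s t₁) ^ (1 / r - 1)) with hc
  have hcc : Continuous c := by
    refine continuous_const.mul (continuous_const.mul ?_)
    exact (continuous_const.sub (continuous_id.min continuous_const)).rpow_const
      fun s => Or.inl (sub_pos.2 (hmin s)).ne'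
  have hc0 : ∀ s, 0 ≤ c s := fun s =>
    mul_nonneg hM0 (mul_nonneg (inv_nonneg.2 hr0.le) (Real.rpow_nonneg (sub_pos.2 (hmin s)).le _))
  set Γ : ℝ → ℝ := fun s => ∫ τ in (0 : ℝ)..s, c τ with hΓ
  have hΓd : ∀ s, HasDerivAt Γ (c s) s := fun s =>
    (hcc.integral_hasStrictDerivAt 0 s).hasDerivAt
  have hΓ0 : Γ 0 = 0 := by simp [hΓ]
  have hΓG : ∀ s ∈ Icc 0 t₁, Γ s = M * (T ^ (1 / r) - (T - s) ^ (1 / r)) := by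
    intro s hs
    have h1 : (∫ τ in (0 : ℝ)..s, c τ) =
        ∫ τ in (0 : ℝ)..s, M * (r⁻¹ * (T - τ) ^ (1 / r - 1)) := by
      refine intervalIntegral.integral_congr fun τ hτ => ?_
      rw [uIcc_of_le hs.1] at hτ
      simp only [hc, min_eq_left (hτ.2.trans hs.2)]
    simp only [hΓ]
    rw [h1, coneRadius_eq_integral hs.1 (hs.2.trans_lt ht₁)]
  -- apply the domain-of-dependence theorem with the variable speed bound
  have hT : ∀ s ∈ Ioo 0 t₁, s < T := fun s hs => hs.2.trans ht₁
  refine IsentropicEuler.eqOn_cone_of_eqOn_ball_var (α := 1 / 3) (c := c) (Γ := Γ) (R := R)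
    (x₀ := x₀) hsm.1 hu₂ hsm.2 hσ₂ (fun s hs y _ => ?_) (fun s hs y hy => ?_)
    (fun s hs y _ => ?_) hcc hc0 hΓd hΓ0 h0 ht ?_
  · -- the exact solution solves the `(u, σ)`-system
    obtain ⟨-, -, -, -, hMom, hZ⟩ :=
      uσ_system_of_ansatz hr0.ne' hUb1 hSb1 hP1 hP2 hu hσ (hT s hs) y
    exact ⟨hZ, hMom⟩
  · -- the second solution, on the cone written with `Γ`
    refine hE₂ s hs y ?_
    rwa [hΓG s ⟨hs.1.le, hs.2.le⟩] at hy
  · -- the speed bound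
    have h := hM s (hT s hs) y
    simp only [hc, min_eq_left hs.2.le]
    exact h
  · rwa [hΓG t ⟨ht.1, ht.2.le⟩]

/-- **Domain of dependence at the implosion core, periodic classical solutions.** Let `(ρ, u)`,
`ρ = (σ/3)³`, be the exact self-similar solution of the isentropic Euler equations of the
monatomic gas (`γ = 5/3`) generated by a profile as in
`BuckmasterCaolaboraGomezserrano2025_thm11_monatomic` (`r > 1`, `S̄ > 0`, blow-up time `T`). There
is `M ≥ 0` such that every classical solution `(ρ₂, u₂)` on `[0, T₂) × 𝕋³`
(`IsIsentropicEulerSolution (5/3) T₂ ρ₂ u₂`) whose lifted data agree with `(ρ, u)(0, ·)` on the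
ball `‖y − x₀‖ < R` of `ℝ³` has its lift EQUAL to `(ρ, u)` on the curved cone
`‖y − x₀‖ + M (T^{1/r} − (T−t)^{1/r}) < R` for `0 ≤ t < T₂`, `t < T` ("the Euler result with
periodic boundary conditions … can be easily deduced from the non-periodic one … via finite speed
of propagation"). Proof: `eqOn_cone_of_profile` for the lift in the variables
`(u, σ = 3ρ^{1/3})` (`IsentropicEuler.uσ_equations` at `γ = 5/3`, `α = 1/3`).
[cite: CaolaboraEtAl2025, Rem 1.5 p. 7] [cite: Dafermos2005, §5.2, Thm 5.2.1] -/
theorem lift_eq_exact_on_cone {T : ℝ} {Ub : V3 → V3} {Sb : V3 → ℝ} {u : ℝ → V3 → V3}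
    {σ ρ : ℝ → V3 → ℝ} (hr : 1 < r)
    (hU : ContDiff ℝ ∞ fun y : V3 => (U ‖y‖ / ‖y‖) • y) (hS : ContDiff ℝ ∞ fun y : V3 => S ‖y‖)
    (hode : ∀ ζ : ℝ, 0 < ζ →
      (r - 1) * U ζ + (ζ + U ζ) * deriv U ζ + 1 / 3 * S ζ * deriv S ζ = 0 ∧
      (r - 1) * S ζ + (ζ + U ζ) * deriv S ζ + 1 / 3 * S ζ * (deriv U ζ + 2 * U ζ / ζ) = 0)
    (hSpos : ∀ ζ : ℝ, 0 ≤ ζ → 0 < S ζ)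
    (hlimU : Tendsto (fun ζ => U ζ / ζ) atTop (𝓝 0))
    (hlimS : Tendsto (fun ζ => S ζ / ζ) atTop (𝓝 0))
    (hUb : Ub = fun y : V3 => (U ‖y‖ / ‖y‖) • y) (hSb : Sb = fun y : V3 => S ‖y‖)
    (hu : ∀ t x, u t x = (r⁻¹ * (T - t) ^ (1 / r - 1)) • Ub ((T - t) ^ (-1 / r) • x))
    (hσ : ∀ t x, σ t x = (r⁻¹ * (T - t) ^ (1 / r - 1)) * Sb ((T - t) ^ (-1 / r) • x))
    (hρ : ∀ t x, ρ t x = (σ t x / 3) ^ 3) :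
    ∃ M : ℝ, 0 ≤ M ∧ ∀ ⦃T₂ : ℝ⦄ ⦃ρ₂ : ℝ → T3 → ℝ⦄ ⦃u₂ : ℝ → T3 → V3⦄ ⦃x₀ : V3⦄ ⦃R : ℝ⦄,
      IsIsentropicEulerSolution (5 / 3) T₂ ρ₂ u₂ →
      (∀ y : V3, ‖y - x₀‖ < R → ρ₂ 0 (Torus.proj y) = ρ 0 y ∧ u₂ 0 (Torus.proj y) = u 0 y) →
      ∀ ⦃t : ℝ⦄, t ∈ Ico 0 T₂ → t < T → ∀ ⦃y : V3⦄,
        ‖y - x₀‖ + M * (T ^ (1 / r) - (T - t) ^ (1 / r)) < R →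
        ρ₂ t (Torus.proj y) = ρ t y ∧ u₂ t (Torus.proj y) = u t y := by
  obtain ⟨M, hM0, hM⟩ := eqOn_cone_of_profile hr hU hS hode hlimU hlimS hUb hSb hu hσ
  refine ⟨M, hM0, ?_⟩
  intro T₂ ρ₂ u₂ x₀ R h₂ h0 t ht htT y hy
  have hr0 : 0 < r := one_pos.trans hr
  -- positivity of `σ` before the blow-up time
  have hσpos : ∀ s < T, ∀ z, 0 < σ s z := by
    intro s hs z
    rw [hσ, hSb]
    exact mul_pos (mul_pos (inv_pos.mpr hr0) (Real.rpow_pos_of_pos (sub_pos.mpr hs) _))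
      (hSpos _ (norm_nonneg _))
  -- a slab `[0, t₁)` with `t < t₁ ≤ T₂`, `t₁ < T`
  set t₁ : ℝ := min T₂ ((t + T) / 2) with ht₁
  have htt₁ : t < t₁ := lt_min ht.2 (by linarith)
  have ht₁T₂ : t₁ ≤ T₂ := min_le_left _ _
  have ht₁T : t₁ < T := (min_le_right _ _).trans_lt (by linarith)
  have hγ : (1 : ℝ) < 5 / 3 := by norm_num
  have hα : ((5 : ℝ) / 3 - 1) / 2 = 1 / 3 := by norm_num
  have hT0 : (0 : ℝ) < T := ht.1.trans_lt htT
  -- the cone theorem for the lift, in the variables `(u, σ = 3ρ^{1/3})`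
  have key := hM ht₁T (u₂ := fun s z => u₂ s (Torus.proj z))
    (σ₂ := fun s z => (1 / 3 : ℝ)⁻¹ * ρ₂ s (Torus.proj z) ^ (1 / 3 : ℝ)) (x₀ := x₀) (R := R)
    (IsentropicEuler.contDiffOn_lift_velocity h₂ ht₁T₂)
    (IsentropicEuler.contDiffOn_lift_soundSpeed h₂ (1 / 3) ht₁T₂)
    (fun s hs z _ => ?_) (fun z hz => ?_) ⟨ht.1, htt₁⟩ hy
  rotate_left
  · -- the `(u, σ)`-system for the lift (`α = (5/3 − 1)/2 = 1/3`)
    have h := IsentropicEuler.uσ_equations h₂ hγ ⟨hs.1, hs.2.trans_le ht₁T₂⟩ z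
    rw [hα] at h
    exact h
  · -- the data agree on the ball
    refine ⟨(h0 z hz).2.symm, ?_⟩
    show σ 0 z = (1 / 3 : ℝ)⁻¹ * ρ₂ 0 (Torus.proj z) ^ (1 / 3 : ℝ)
    rw [(h0 z hz).1, hρ, cube_rpow_third (div_pos (hσpos 0 hT0 z) three_pos)]
    ring
  -- back to `ρ = (σ/3)³`
  refine ⟨?_, key.1.symm⟩
  have hp : 0 < ρ₂ t (Torus.proj y) := h₂.density_pos t ht _
  have h3 : ρ₂ t (Torus.proj y) ^ (1 / 3 : ℝ) = σ t y / 3 := by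
    have h : σ t y = (1 / 3 : ℝ)⁻¹ * ρ₂ t (Torus.proj y) ^ (1 / 3 : ℝ) := key.2
    rw [h]
    ring
  calc ρ₂ t (Torus.proj y) = (ρ₂ t (Torus.proj y) ^ (1 / 3 : ℝ)) ^ (3 : ℕ) := by
        rw [← Real.rpow_natCast, ← Real.rpow_mul hp.le]; norm_num
    _ = ρ t y := by rw [h3, hρ]

/-- **The core growth law is forced by the local data.** In the setting of
`lift_eq_exact_on_cone`: if the core stays inside the cone, `‖x₀‖ + M T^{1/r} < R`, then the
density of ANY periodic classical solution (`γ = 5/3`) with these local data is, at the core,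
EXACTLY `ρ₂(t, 0) = (S̄(0)/(3r))³ (T−t)^{−3(1−1/r)}` for `0 ≤ t < T₂`, `t < T` — the
self-similar core growth `ρ ≍ (T−t)^{−(1−1/r)/α}`, `α = 1/3`, of Thm 1.2 of the source (last
clause of the named fact `CaolaboraEtAl2025_thm12_rates`).
[cite: CaolaboraEtAl2025, Thm 1.2 p. 6 and Rem 1.5 p. 7] [cite: Dafermos2005, §5.2, Thm 5.2.1] -/
theorem core_density_of_periodic_solution {T : ℝ} {Ub : V3 → V3} {Sb : V3 → ℝ}
    {u : ℝ → V3 → V3} {σ ρ : ℝ → V3 → ℝ} (hr : 1 < r)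
    (hU : ContDiff ℝ ∞ fun y : V3 => (U ‖y‖ / ‖y‖) • y) (hS : ContDiff ℝ ∞ fun y : V3 => S ‖y‖)
    (hode : ∀ ζ : ℝ, 0 < ζ →
      (r - 1) * U ζ + (ζ + U ζ) * deriv U ζ + 1 / 3 * S ζ * deriv S ζ = 0 ∧
      (r - 1) * S ζ + (ζ + U ζ) * deriv S ζ + 1 / 3 * S ζ * (deriv U ζ + 2 * U ζ / ζ) = 0)
    (hSpos : ∀ ζ : ℝ, 0 ≤ ζ → 0 < S ζ)
    (hlimU : Tendsto (fun ζ => U ζ / ζ) atTop (𝓝 0))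
    (hlimS : Tendsto (fun ζ => S ζ / ζ) atTop (𝓝 0))
    (hUb : Ub = fun y : V3 => (U ‖y‖ / ‖y‖) • y) (hSb : Sb = fun y : V3 => S ‖y‖)
    (hu : ∀ t x, u t x = (r⁻¹ * (T - t) ^ (1 / r - 1)) • Ub ((T - t) ^ (-1 / r) • x))
    (hσ : ∀ t x, σ t x = (r⁻¹ * (T - t) ^ (1 / r - 1)) * Sb ((T - t) ^ (-1 / r) • x))
    (hρ : ∀ t x, ρ t x = (σ t x / 3) ^ 3) :
    ∃ M : ℝ, 0 ≤ M ∧ ∀ ⦃T₂ : ℝ⦄ ⦃ρ₂ : ℝ → T3 → ℝ⦄ ⦃u₂ : ℝ → T3 → V3⦄ ⦃x₀ : V3⦄ ⦃R : ℝ⦄,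
      IsIsentropicEulerSolution (5 / 3) T₂ ρ₂ u₂ →
      (∀ y : V3, ‖y - x₀‖ < R → ρ₂ 0 (Torus.proj y) = ρ 0 y ∧ u₂ 0 (Torus.proj y) = u 0 y) →
      ‖x₀‖ + M * T ^ (1 / r) < R →
      ∀ ⦃t : ℝ⦄, t ∈ Ico 0 T₂ → t < T →
        ρ₂ t (Torus.proj 0) = (S 0 / (3 * r)) ^ 3 * (T - t) ^ (-(3 * (1 - 1 / r))) := by
  obtain ⟨M, hM0, hM⟩ := lift_eq_exact_on_cone hr hU hS hode hSpos hlimU hlimS hUb hSb hu hσ hρ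
  refine ⟨M, hM0, ?_⟩
  intro T₂ ρ₂ u₂ x₀ R h₂ h0 hR t ht htT
  have hr0 : 0 < r := one_pos.trans hr
  have h1 : M * (T ^ (1 / r) - (T - t) ^ (1 / r)) ≤ M * T ^ (1 / r) :=
    mul_le_mul_of_nonneg_left (sub_le_self _ (Real.rpow_nonneg (sub_pos.2 htT).le _)) hM0
  have hcone : ‖(0 : V3) - x₀‖ + M * (T ^ (1 / r) - (T - t) ^ (1 / r)) < R := by
    rw [zero_sub, norm_neg]; linarith
  rw [(hM h₂ h0 ht htT hcone).1]
  exact (exactSolution_of_profile hr0 hU hS hode hSpos hUb hSb hu hσ hρ).2.2.2.2.2.1 t htT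

/-- **Corollary from the vendored profile fact** (`BuckmasterCaolaboraGomezserrano2025_thm11_monatomic`,
Buckmaster–Cao-Labora–Gómez-Serrano Thm 1.1 at `γ = 5/3`): there are a self-similar exponent `r` in
the window `(1.10102, 1.13476)` and `c > 0` such that for every blow-up time `T` the exact
self-similar solution `(ρ, u)` of the isentropic Euler equations of the monatomic gas on
`(−∞, T) × ℝ³` (jointly `C^∞`, `ρ > 0`) comes with an acoustic bound `M ≥ 0` for which: every
classical solution on `[0, T₂) × 𝕋³` (`γ = 5/3`) whose lifted data agree with `(ρ, u)(0, ·)` on a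
ball `‖y − x₀‖ < R` with `‖x₀‖ + M T^{1/r} < R` has core density EXACTLY
`ρ₂(t, 0) = c (T−t)^{−3(1−1/r)}` for `0 ≤ t < T₂`, `t < T` (Rem 1.5 of the source: the periodic
Euler implosion "can be easily deduced from the non-periodic one … via finite speed of
propagation" — this is the propagation step; the existence of such a periodic solution up to
time `T` is Thm 1.2 itself and is not proved here).
[cite: CaolaboraEtAl2025, Thm 1.2 p. 6, Rem 1.5 p. 7] [cite: BuckmasterCaolaboraGomezserrano2025, Thm 1.1 p. 4]
[cite: Dafermos2005, §5.2, Thm 5.2.1] -/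
theorem core_law_of_thm11_monatomic (hX : BuckmasterCaolaboraGomezserrano2025_thm11_monatomic) :
    ∃ r : ℝ, 1.10102 < r ∧ r < 1.13476 ∧ ∃ c : ℝ, 0 < c ∧ ∀ T : ℝ,
      ∃ (ρ : ℝ → V3 → ℝ) (u : ℝ → V3 → V3),
        ContDiffOn ℝ ∞ (fun p : ℝ × V3 => ρ p.1 p.2) {p | p.1 < T} ∧
        ContDiffOn ℝ ∞ (fun p : ℝ × V3 => u p.1 p.2) {p | p.1 < T} ∧
        (∀ t < T, ∀ x, 0 < ρ t x) ∧
        (∀ t < T, ∀ x, deriv (fun τ => ρ τ x) t +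
            ∑ i, fderiv ℝ (fun z => ρ t z * u t z i) x (EuclideanSpace.single i 1) = 0) ∧
        (∀ t < T, ∀ x, ρ t x • deriv (fun τ => u τ x) t +
              ρ t x • ∑ i, u t x i • fderiv ℝ (u t) x (EuclideanSpace.single i 1) +
            gradient (fun z => ρ t z ^ (5 / 3 : ℝ) / (5 / 3)) x = 0) ∧
        ∃ M : ℝ, 0 ≤ M ∧ ∀ ⦃T₂ : ℝ⦄ ⦃ρ₂ : ℝ → T3 → ℝ⦄ ⦃u₂ : ℝ → T3 → V3⦄ ⦃x₀ : V3⦄ ⦃R : ℝ⦄,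
          IsIsentropicEulerSolution (5 / 3) T₂ ρ₂ u₂ →
          (∀ y : V3, ‖y - x₀‖ < R →
            ρ₂ 0 (Torus.proj y) = ρ 0 y ∧ u₂ 0 (Torus.proj y) = u 0 y) →
          ‖x₀‖ + M * T ^ (1 / r) < R →
          ∀ ⦃t : ℝ⦄, t ∈ Ico 0 T₂ → t < T →
            ρ₂ t (Torus.proj 0) = c * (T - t) ^ (-(3 * (1 - 1 / r))) := by
  obtain ⟨r, hr1, hr2, U, S, hU, hS, hode, hpos, hlimU, hlimS⟩ := hX
  have hr : 0 < r := by linarith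
  have hr' : 1 < r := by linarith
  refine ⟨r, hr1, hr2, (S 0 / (3 * r)) ^ 3, pow_pos (div_pos (hpos 0 le_rfl) (by positivity)) 3,
    fun T => ?_⟩
  set Ub : V3 → V3 := fun y => (U ‖y‖ / ‖y‖) • y with hUb
  set Sb : V3 → ℝ := fun y => S ‖y‖ with hSb
  set u : ℝ → V3 → V3 := fun t x => (r⁻¹ * (T - t) ^ (1 / r - 1)) • Ub ((T - t) ^ (-1 / r) • x)
    with hu
  set σ : ℝ → V3 → ℝ := fun t x => (r⁻¹ * (T - t) ^ (1 / r - 1)) * Sb ((T - t) ^ (-1 / r) • x)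
    with hσ
  set ρ : ℝ → V3 → ℝ := fun t x => (σ t x / 3) ^ 3 with hρ
  obtain ⟨h1, h2, h3, h4, h5, -, -⟩ := exactSolution_of_profile (T := T) (u := u) (σ := σ)
    (ρ := ρ) hr hU hS hode hpos hUb hSb (fun _ _ => rfl) (fun _ _ => rfl) (fun _ _ => rfl)
  obtain ⟨M, hM0, hM⟩ := core_density_of_periodic_solution (T := T) (u := u) (σ := σ) (ρ := ρ)
    hr' hU hS hode hpos hlimU hlimS hUb hSb (fun _ _ => rfl) (fun _ _ => rfl) (fun _ _ => rfl)
  exact ⟨ρ, u, h1, h2, h3, h4, h5, M, hM0, hM⟩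

end Cone

end CaolaboraEtAl2025

end Literature.Analysis.FluidPDE
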